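import Literature.Topology.FourManifolds.BoundaryGluingData
import Literature.Topology.FourManifolds.SeamAdaptedWitnesses
import Mathlib.Geometry.Manifold.PartitionOfUnity
import Mathlib.Analysis.Calculus.LocalExtr.Basic
import HarnessLib

/-!
# Functions on a gluing adapted to the seam: extension across the seam, seam height functions

Second file of the proof of the tree's named fact
`Literature.Topology.FourManifolds.nonempty_diffeomorph_of_isBoundaryGluing` (`Gluing.lean`;
Hirsch (1976), Ch. 8, Thm. 2.1 / Thm. 1.9; Bröcker–Jänich (1982), (13.9)).  For gluing data
`G : BoundaryGluingData bM bN φ P` of compact Hausdorff pieces (`BoundaryGluingData.lean`) we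
prove, by partitions of unity over the flat charts at seam points:

* `BoundaryGluingData.exists_contMDiff_comp_jA_eq` — **smooth functions on the piece `M`
  extend across the seam**: every `C^∞` function `g : M → ℝ` (smooth up to the boundary) is
  `g̃ ∘ jA` for a `C^∞` function `g̃ : P → ℝ`.  Locally this is Seeley's extension theorem for
  the half space (`Literature.Topology.FourManifolds.exists_contDiffOn_extension_halfSpace`,
  `SeamBicollar.lean`; R. T. Seeley, Proc. AMS 15 (1964)); the local extensions are glued by a
  smooth partition of unity on `P` (which is Hausdorff and compact by `BoundaryGluingData.lean`).
* `BoundaryGluingData.exists_seamFunction` — **a seam height function**: a `C^∞` function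
  `f : P → ℝ` vanishing exactly on the seam, positive exactly on `jA (Int M)`, negative exactly
  on `jB (Int N)`, with nonzero differential along the seam (so that `0` is a regular value and
  `f⁻¹(0)` is the seam).  It is glued from the height coordinates `u ↦ u 0` of flat charts; the
  regularity along the seam rests on the calculus lemma `fderiv_apply_zero_pos_of_flat`: a local
  diffeomorphism of `ℝⁿ⁺¹` preserving the hyperplane `{u 0 = 0}` and the side `{0 ≤ u 0}` near a
  hyperplane point has positive normal–normal derivative there (nonnegative by one-sided
  minimality, nonzero by invertibility; compare the tree's `fderiv_germ_upNormal_pos`,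
  `SeamAdaptedWitnesses.lean`, for germs fixing the hyperplane pointwise).  Bröcker–Jänich
  (1982), (13.18) Ex. 2 ("on each manifold with boundary there exists a differentiable function
  with `f⁻¹(0) = ∂M`"); Hirsch (1976), Ch. 6 §2 (the seam as a regular level).

Everything here is proved; no named facts are introduced.

## References

* R. T. Seeley, *Extension of `C^∞` functions defined in a half space*, Proc. AMS 15 (1964),
  625–626. [Seeley1964]
* M. W. Hirsch, *Differential Topology*, GTM 33 (1976), Ch. 8 §1 Thm. 1.9, §2 Thm. 2.1.
  [HirschDT1976]
* Th. Bröcker, K. Jänich, *Introduction to Differential Topology* (1982), §13. [BrockerJanich1982]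
-/

open scoped Manifold ContDiff Topology
open Set Function Metric Filter Topology

noncomputable section

namespace Literature.Topology.FourManifolds

universe u w

/-- Local notation: `𝔼 n` is the model Euclidean space `EuclideanSpace ℝ (Fin n)`. -/
local notation "𝔼 " n:arg => EuclideanSpace ℝ (Fin n)
/-- Local notation: `ℍ n` is the closed half space `EuclideanHalfSpace n`. -/
local notation "ℍ " n:arg => EuclideanHalfSpace n

/-! ### §1 A calculus lemma: flat local diffeomorphisms have positive normal derivative -/

section Flat

variable {n : ℕ}

/-- The unit upward normal `e₀ = (1, 0, …, 0)` of the tree (`upNormal`, `SeamAdaptedWitnesses.lean`)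
has vanishing later coordinates. [folklore] -/
theorem upNormal_apply_of_ne_zero {i : Fin (n + 1)} (hi : i ≠ 0) : upNormal n i = 0 := by
  obtain ⟨j, rfl⟩ := Fin.exists_succ_eq.2 hi
  simp [upNormal]

/-- Along the line `t ↦ c + t • v` a map `τ`, differentiable at `c`, has derivative `Dτ(c) v` in
the height coordinate: `d/dt (τ (c + t v)) 0 = (Dτ(c) v) 0` at `t = 0`. [folklore] -/
theorem hasDerivAt_apply_zero_comp_line {τ : 𝔼 (n + 1) → 𝔼 (n + 1)} {c : 𝔼 (n + 1)}
    {L : 𝔼 (n + 1) →L[ℝ] 𝔼 (n + 1)} (hτ : HasFDerivAt τ L c) (v : 𝔼 (n + 1)) :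
    HasDerivAt (fun t : ℝ => τ (c + t • v) 0) (L v 0) 0 := by
  have hline : HasDerivAt (fun t : ℝ => c + t • v) v 0 := by
    simpa using ((hasDerivAt_id (0 : ℝ)).smul_const v).const_add c
  have h1 : HasDerivAt (fun t : ℝ => τ (c + t • v)) (L v) 0 := by
    have := hτ.comp_hasDerivAt_of_eq (x := (0 : ℝ)) hline (by simp)
    exact this
  exact ((EuclideanSpace.proj (0 : Fin (n + 1))).hasFDerivAt.comp_hasDerivAt (0 : ℝ) h1)

/-- **Flat local diffeomorphisms have positive normal–normal derivative.** Let `τ` be `C¹` at a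
point `c` of the hyperplane `{u 0 = 0}` of `ℝⁿ⁺¹`, with a left inverse `τ'` near `c` which is
differentiable at `τ c`, and suppose that near `c` the map `τ` preserves the side `{0 ≤ u 0}` and
the hyperplane `{u 0 = 0}` (as sets of source points: `0 ≤ (τ u) 0 ↔ 0 ≤ u 0` and
`(τ u) 0 = 0 ↔ u 0 = 0`).  Then `0 < (Dτ(c) e₀) 0`: the derivative maps the hyperplane into
itself (differentiate `τ` along lines in the hyperplane, on which the height vanishes
identically) and is injective, so `e₀` is not mapped into the hyperplane; and the entry is
nonnegative because `t ↦ (τ (c + t e₀)) 0` is nonnegative for `t ≥ 0` and vanishes at `0`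
(one-sided first-order condition, Mathlib `IsLocalMinOn.hasFDerivWithinAt_nonneg`).  This is the
infinitesimal form of "transition maps of boundary charts preserve the boundary" (Bröcker–Jänich
(1982), (13.2)–(13.3); Hirsch (1976), Ch. 1 §4). [folklore] -/
theorem fderiv_apply_zero_pos_of_flat {τ τ' : 𝔼 (n + 1) → 𝔼 (n + 1)} {c : 𝔼 (n + 1)}
    (hτ : ContDiffAt ℝ 1 τ c) (hτ' : DifferentiableAt ℝ τ' (τ c))
    (hinv : ∀ᶠ u in 𝓝 c, τ' (τ u) = u) (hc : c 0 = 0)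
    (hside : ∀ᶠ u in 𝓝 c, 0 ≤ τ u 0 ↔ 0 ≤ u 0) (hplane : ∀ᶠ u in 𝓝 c, τ u 0 = 0 ↔ u 0 = 0) :
    0 < fderiv ℝ τ c (upNormal n) 0 := by
  set L := fderiv ℝ τ c with hL
  have hτd : HasFDerivAt τ L c := (hτ.differentiableAt one_ne_zero).hasFDerivAt
  -- (i) `L` is injective: `Dτ'(τ c) ∘ L = id`
  have hLinj : Function.Injective L := by
    have hcomp : HasFDerivAt (τ' ∘ τ) ((fderiv ℝ τ' (τ c)).comp L) c :=
      hτ'.hasFDerivAt.comp c hτd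
    have hid : HasFDerivAt (τ' ∘ τ) (ContinuousLinearMap.id ℝ _) c :=
      (hasFDerivAt_id c).congr_of_eventuallyEq (hinv.mono fun u hu => by simpa using hu)
    have heq := hcomp.unique hid
    intro v w hvw
    have h1 : (fderiv ℝ τ' (τ c)).comp L v = (fderiv ℝ τ' (τ c)).comp L w := by
      simp only [ContinuousLinearMap.comp_apply, hvw]
    rwa [heq] at h1
  -- (ii) `L` maps the hyperplane into the hyperplane
  have hLplane : ∀ v : 𝔼 (n + 1), v 0 = 0 → L v 0 = 0 := by
    intro v hv
    have hder := hasDerivAt_apply_zero_comp_line hτd v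
    have hzero : (fun t : ℝ => τ (c + t • v) 0) =ᶠ[𝓝 0] fun _ => 0 := by
      have hcont : Tendsto (fun t : ℝ => c + t • v) (𝓝 0) (𝓝 c) := by
        have : Continuous fun t : ℝ => c + t • v := by fun_prop
        simpa using this.tendsto 0
      filter_upwards [hcont.eventually hplane] with t ht
      exact ht.2 (by simp [hc, hv])
    have hder0 : HasDerivAt (fun t : ℝ => τ (c + t • v) 0) 0 0 :=
      (hasDerivAt_const (0 : ℝ) (0 : ℝ)).congr_of_eventuallyEq hzero
    exact hder.unique hder0
  -- (iii) the normal entry is nonnegative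
  have hnonneg : 0 ≤ L (upNormal n) 0 := by
    have hder := hasDerivAt_apply_zero_comp_line hτd (upNormal n)
    have hmin : IsLocalMinOn (fun t : ℝ => τ (c + t • upNormal n) 0) (Ici 0) 0 := by
      have hcont : Tendsto (fun t : ℝ => c + t • upNormal n) (𝓝[Ici 0] 0) (𝓝 c) := by
        have : Continuous fun t : ℝ => c + t • upNormal n := by fun_prop
        simpa using (this.tendsto 0).mono_left nhdsWithin_le_nhds
      have h0 : τ (c + (0 : ℝ) • upNormal n) 0 = 0 := by
        simpa [hc] using (hplane.self_of_nhds : τ c 0 = 0 ↔ c 0 = 0)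
      show ∀ᶠ t in 𝓝[Ici 0] (0 : ℝ), τ (c + (0 : ℝ) • upNormal n) 0 ≤ τ (c + t • upNormal n) 0
      filter_upwards [hcont.eventually hside, self_mem_nhdsWithin] with t ht ht0
      rw [h0]
      exact ht.2 (by simpa [hc] using ht0)
    have h1 : (1 : ℝ) ∈ posTangentConeAt (Ici (0 : ℝ)) 0 := by
      have hseg : segment ℝ (0 : ℝ) (0 + 1) ⊆ Ici 0 := fun x hx => by
        rw [zero_add, segment_eq_Icc (zero_le_one' ℝ)] at hx; exact hx.1
      exact mem_posTangentConeAt_of_segment_subset hseg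
    have := hmin.hasFDerivWithinAt_nonneg hder.hasFDerivAt.hasFDerivWithinAt h1
    simpa using this
  -- (iv) the normal entry is nonzero: `L` is onto, and everything else lands in the hyperplane
  have hne : L (upNormal n) 0 ≠ 0 := by
    intro h0
    have hsurj : Function.Surjective L :=
      (LinearMap.injective_iff_surjective (f := (L : 𝔼 (n + 1) →ₗ[ℝ] 𝔼 (n + 1)))).1 hLinj
    obtain ⟨w, hw⟩ := hsurj (upNormal n)
    set w' := w - w 0 • upNormal n with hw'
    have hw'0 : w' 0 = 0 := by simp [hw']
    have hdecomp : w = w 0 • upNormal n + w' := by rw [hw']; abel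
    have := congrArg (fun x : 𝔼 (n + 1) => x 0) hw
    simp only at this
    rw [hdecomp, map_add, map_smul] at this
    simp only [PiLp.add_apply, PiLp.smul_apply, smul_eq_mul, h0, mul_zero, hLplane w' hw'0,
      add_zero, upNormal_apply_zero] at this
    exact zero_ne_one this
  exact lt_of_le_of_ne hnonneg (Ne.symm hne)

end Flat

/-! ### §2 Gluing data of compact Hausdorff pieces: conventions and small lemmas -/

section Pieces

variable {n : ℕ} {M N : Type u} [TopologicalSpace M] [ChartedSpace (ℍ (n + 1)) M]
  [TopologicalSpace N] [ChartedSpace (ℍ (n + 1)) N]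
  {bM : BoundaryData (𝓡∂ (n + 1)) M (𝓡 n)} {bN : BoundaryData (𝓡∂ (n + 1)) N (𝓡 n)}
  {φ : bM.carrier ≃ bN.carrier}
  {P : Type w} [TopologicalSpace P] [ChartedSpace (𝔼 (n + 1)) P]
  (G : BoundaryGluingData bM bN φ P)

namespace BoundaryGluingData

/-- Images of interior points of `M` are not on the seam. [folklore] -/
theorem not_mem_seam_of_mem_image_interior {p : P} (hp : p ∈ G.jA '' (𝓡∂ (n + 1)).interior M) :
    p ∉ G.seam := by
  rintro hs
  obtain ⟨a, ha, rfl⟩ := hp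
  rw [G.jA_mem_seam_iff, bM.range_incl, ← ModelWithCorners.compl_interior] at hs
  exact hs ha

/-- Images of interior points of `N` are not on the seam. [folklore] -/
theorem not_mem_seam_of_mem_image_interior' {p : P} (hp : p ∈ G.jB '' (𝓡∂ (n + 1)).interior N) :
    p ∉ G.seam := by
  rw [← G.symm_seam]; exact G.symm.not_mem_seam_of_mem_image_interior hp

/-- Images of interior points of `N` are not in the first piece. [folklore] -/
theorem not_mem_range_jA_of_mem_image_interior' {p : P}
    (hp : p ∈ G.jB '' (𝓡∂ (n + 1)).interior N) : p ∉ range G.jA := by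
  have h := G.symm.image_jA_interior_eq_compl
  simp only [symm_jA, symm_jB] at h
  rw [h] at hp; exact hp

/-- Images of interior points of `M` are not in the second piece. [folklore] -/
theorem not_mem_range_jB_of_mem_image_interior {p : P}
    (hp : p ∈ G.jA '' (𝓡∂ (n + 1)).interior M) : p ∉ range G.jB := by
  rw [G.image_jA_interior_eq_compl] at hp; exact hp

/-- A choice of flat chart at each seam point. [folklore] -/
def flatChart [IsManifold (𝓡∂ (n + 1)) ∞ M] [IsManifold (𝓡 (n + 1)) ∞ P] (z : bM.carrier) :
    G.FlatChart z :=
  Classical.choice (G.nonempty_flatChart z)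

end BoundaryGluingData

end Pieces

/-! ### §3 Smooth functions on a piece extend across the seam -/

section Extend

variable {n : ℕ} {M N : Type u} [TopologicalSpace M] [ChartedSpace (ℍ (n + 1)) M]
  [TopologicalSpace N] [ChartedSpace (ℍ (n + 1)) N]
  {bM : BoundaryData (𝓡∂ (n + 1)) M (𝓡 n)} {bN : BoundaryData (𝓡∂ (n + 1)) N (𝓡 n)}
  {φ : bM.carrier ≃ bN.carrier}
  {P : Type w} [TopologicalSpace P] [ChartedSpace (𝔼 (n + 1)) P]
  (G : BoundaryGluingData bM bN φ P)

namespace BoundaryGluingData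

/-- **Local Seeley extension at a seam point.** For a `C^∞` function `g` on `M` and a flat chart
`F` at `z`, there are an open set `V ∋ F.center` of `ℝⁿ⁺¹` and a function `gext`, `C^∞` on `V`,
with `gext ((F.domChart y).val) = g y` whenever `(F.domChart y).val ∈ V` (Seeley's theorem in
the coordinates of the flat chart, `exists_contDiffOn_extension_halfSpace`).
[cite: Seeley1964, Theorem] -/
theorem FlatChart.exists_local_extension {z : bM.carrier} (F : G.FlatChart z) {g : M → ℝ}
    (hg : ContMDiff (𝓡∂ (n + 1)) 𝓘(ℝ, ℝ) ∞ g) :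
    ∃ V : Set (𝔼 (n + 1)), IsOpen V ∧ F.center ∈ V ∧ ∃ gext : 𝔼 (n + 1) → ℝ,
      ContDiffOn ℝ ∞ gext V ∧
      ∀ y ∈ F.domChart.source, (F.domChart y).val ∈ V → gext (F.domChart y).val = g y := by
  set ψ := F.domChart.extend (𝓡∂ (n + 1)) with hψ
  -- `g` read in the domain chart is `C^∞` on the image of the chart, within the half space
  have h1 : ContDiffOn ℝ ∞ (g ∘ ψ.symm) ((𝓡∂ (n + 1)) '' F.domChart.target) :=
    (hg.comp_contMDiffOn (contMDiffOn_extend_symm F.domChart_mem_maximalAtlas)).contDiffOn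
  have h2 : ContDiffOn ℝ ∞ (g ∘ ψ.symm) (ball F.center F.radius ∩ {u | 0 ≤ u 0}) := by
    refine h1.mono fun u hu => ?_
    obtain ⟨w, hw, rfl⟩ := F.inter_subset hu
    exact ⟨w, hw, rfl⟩
  obtain ⟨V, hV, hcV, hVball, gext, hgext, hagree⟩ :=
    exists_contDiffOn_extension_halfSpace isOpen_ball (mem_ball_self F.radius_pos) h2
  refine ⟨V, hV, hcV, gext, hgext, fun y hy hyV => ?_⟩
  have hy0 : 0 ≤ (F.domChart y).val 0 := (F.domChart y).2
  rw [hagree ⟨hyV, hy0⟩, comp_apply]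
  exact congrArg g (F.domChart.extend_left_inv (I := 𝓡∂ (n + 1)) hy)

variable [T2Space M] [T2Space N] [CompactSpace M] [CompactSpace N]
  [IsManifold (𝓡∂ (n + 1)) ∞ M] [IsManifold (𝓡∂ (n + 1)) ∞ N] [IsManifold (𝓡 (n + 1)) ∞ P]

/-- **Smooth functions on the piece `M` extend across the seam.** For gluing data of compact
Hausdorff pieces, every `C^∞` function `g : M → ℝ` (smooth up to the boundary, in the sense of
`ContMDiff` for the model with boundary) is of the form `g̃ ∘ jA` for a `C^∞` function
`g̃ : P → ℝ` on the glued manifold.  The local extensions of Seeley's theorem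
(`FlatChart.exists_local_extension`), the function `g ∘ jA⁻¹` on the open set `jA (Int M)` and
`0` off `range jA` are glued by a smooth partition of unity on `P` (Hausdorff and compact by
`BoundaryGluingData.t2Space`, `.compactSpace`).  Seeley, Proc. AMS 15 (1964); cf. Hirsch
(1976), Ch. 8 §2 (the structure near the seam). [cite: Seeley1964, Theorem] -/
theorem exists_contMDiff_comp_jA_eq {g : M → ℝ} (hg : ContMDiff (𝓡∂ (n + 1)) 𝓘(ℝ, ℝ) ∞ g) :
    ∃ g' : P → ℝ, ContMDiff (𝓡 (n + 1)) 𝓘(ℝ, ℝ) ∞ g' ∧ ∀ a, g' (G.jA a) = g a := by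
  haveI := G.t2Space
  haveI := G.compactSpace
  rcases isEmpty_or_nonempty M with hM | hM
  · exact ⟨fun _ => 0, contMDiff_const, fun a => (IsEmpty.false a).elim⟩
  -- local data at the seam points
  have hloc := fun z => (G.flatChart z).exists_local_extension G hg
  choose V hV hcV gext hgext hagree using hloc
  -- the open cover of `P` and the local functions
  let U : Option (Option bM.carrier) → Set P := fun i =>
    match i with
    | none => (range G.jA)ᶜ
    | some none => G.jA '' (𝓡∂ (n + 1)).interior M
    | some (some z) => (G.flatChart z).chart.source ∩ (G.flatChart z).chart ⁻¹' V z
  let loc : Option (Option bM.carrier) → P → ℝ := fun i =>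
    match i with
    | none => fun _ => 0
    | some none => g ∘ G.invA
    | some (some z) => gext z ∘ (G.flatChart z).chart
  have hUo : ∀ i, IsOpen (U i) := by
    rintro (_ | _ | z)
    · exact G.isClosed_range_jA.isOpen_compl
    · exact G.isOpen_image_jA_interior
    · exact (G.flatChart z).chart.isOpen_inter_preimage (hV z)
  have hUc : (univ : Set P) ⊆ ⋃ i, U i := by
    intro p _
    rw [mem_iUnion]
    rcases G.mem_seam_or p with ⟨z, rfl⟩ | hA | hB
    · refine ⟨some (some z), (G.flatChart z).mem_source, ?_⟩
      rw [mem_preimage]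
      exact hcV z
    · exact ⟨some none, hA⟩
    · exact ⟨none, G.not_mem_range_jA_of_mem_image_interior' hB⟩
  obtain ⟨ρ, hρ⟩ := SmoothPartitionOfUnity.exists_isSubordinate (𝓡 (n + 1)) isClosed_univ U hUo hUc
  -- agreement of the local functions with `g` on the first piece
  have hagree' : ∀ i a, G.jA a ∈ U i → loc i (G.jA a) = g a := by
    rintro (_ | _ | z) a ha
    · exact absurd (mem_range_self a) ha
    · simp [loc]
    · have hy : a ∈ (G.flatChart z).domChart.source := (G.flatChart z).mem_domChart_source ha.1
      have hval : (G.flatChart z).chart (G.jA a) = ((G.flatChart z).domChart a).val :=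
        (G.flatChart z).chart_jA a hy
      have hV' : ((G.flatChart z).domChart a).val ∈ V z := by rw [← hval]; exact ha.2
      simp only [loc, comp_apply, hval]
      exact hagree z a hy hV'
  refine ⟨fun p => ∑ᶠ i, ρ i p • loc i p, ρ.contMDiff_finsum_smul fun i p hp => ?_, fun a => ?_⟩
  · -- smoothness of the local functions on the supports
    have hpU : p ∈ U i := hρ i hp
    rcases i with _ | _ | z
    · exact contMDiffAt_const
    · obtain ⟨a, ha, rfl⟩ := hpU
      exact contMDiffAt_of_comp_isImmersionAt_of_nhds
        (G.isSmoothEmbedding_jA.isImmersion.isImmersionAt a)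
        (fun _ hW => image_mem_nhds_of_isSmoothEmbedding_of_mem_interior
          G.isSmoothEmbedding_jA ha hW)
        (hg a) (fun a' => by simp [loc])
    · have h1 : ContMDiffAt (𝓡 (n + 1)) 𝓘(ℝ, 𝔼 (n + 1)) ∞ (G.flatChart z).chart p :=
        (G.flatChart z).contMDiffOn.contMDiffAt ((G.flatChart z).chart.open_source.mem_nhds hpU.1)
      have h2 : ContMDiffAt 𝓘(ℝ, 𝔼 (n + 1)) 𝓘(ℝ, ℝ) ∞ (gext z) ((G.flatChart z).chart p) :=
        (contMDiffOn_iff_contDiffOn.2 (hgext z)).contMDiffAt ((hV z).mem_nhds hpU.2)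
      exact h2.comp p h1
  · -- agreement on the first piece
    have := ρ.finsum_smul_mem_convex (mem_univ (G.jA a)) (g := loc) (t := {g a})
      (fun i hi => ?_) (convex_singleton _)
    · simpa using this
    · exact hagree' i a (hρ i (subset_tsupport _ hi))

/-- **Smooth functions on the piece `N` extend across the seam.** [cite: Seeley1964, Theorem] -/
theorem exists_contMDiff_comp_jB_eq {g : N → ℝ} (hg : ContMDiff (𝓡∂ (n + 1)) 𝓘(ℝ, ℝ) ∞ g) :
    ∃ g' : P → ℝ, ContMDiff (𝓡 (n + 1)) 𝓘(ℝ, ℝ) ∞ g' ∧ ∀ b, g' (G.jB b) = g b :=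
  G.symm.exists_contMDiff_comp_jA_eq hg

end BoundaryGluingData

end Extend

/-! ### §4 Seam height functions -/

section SeamFunction

variable {n : ℕ} {M N : Type u} [TopologicalSpace M] [ChartedSpace (ℍ (n + 1)) M]
  [TopologicalSpace N] [ChartedSpace (ℍ (n + 1)) N]
  {bM : BoundaryData (𝓡∂ (n + 1)) M (𝓡 n)} {bN : BoundaryData (𝓡∂ (n + 1)) N (𝓡 n)}
  {φ : bM.carrier ≃ bN.carrier}
  {P : Type w} [TopologicalSpace P] [ChartedSpace (𝔼 (n + 1)) P]
  (G : BoundaryGluingData bM bN φ P)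
  [IsManifold (𝓡∂ (n + 1)) ∞ M] [IsManifold (𝓡 (n + 1)) ∞ P]

namespace BoundaryGluingData

/-- **Transitions between flat charts have positive normal derivative along the seam.** If two
flat charts `F₀`, `F` both contain the seam point `p` in their sources, then the transition
`F.chart ∘ F₀.chart⁻¹` at `F₀.chart p` satisfies `0 < (D(F.chart ∘ F₀.chart⁻¹) e₀) 0`
(`fderiv_apply_zero_pos_of_flat`: both charts read `range jA` as `{0 ≤ u 0}` and the seam as
`{u 0 = 0}`). [folklore] -/
theorem FlatChart.fderiv_transition_apply_zero_pos {z₀ z : bM.carrier} (F₀ : G.FlatChart z₀)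
    (F : G.FlatChart z) {p : P} (hp₀ : p ∈ F₀.chart.source) (hp : p ∈ F.chart.source)
    (hps : p ∈ G.seam) :
    0 < fderiv ℝ (F.chart ∘ F₀.chart.symm) (F₀.chart p) (upNormal n) 0 := by
  set c := F₀.chart p with hc_def
  set O : Set (𝔼 (n + 1)) := F₀.chart.target ∩ F₀.chart.symm ⁻¹' F.chart.source with hO
  have hOo : IsOpen O := F₀.chart.symm.isOpen_inter_preimage F.chart.open_source
  have hcO : c ∈ O := ⟨F₀.chart.map_source hp₀, by
    rw [mem_preimage, hc_def, F₀.chart.left_inv hp₀]; exact hp⟩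
  have hOn : O ∈ 𝓝 c := hOo.mem_nhds hcO
  -- the transition and its inverse are smooth
  have hτ : ContDiffOn ℝ ∞ (F.chart ∘ F₀.chart.symm) O := by
    have := F.contMDiffOn.comp (F₀.contMDiffOn_symm.mono inter_subset_left) fun u hu => hu.2
    exact (contMDiffOn_iff_contDiffOn.1 this)
  set O' : Set (𝔼 (n + 1)) := F.chart.target ∩ F.chart.symm ⁻¹' F₀.chart.source with hO'
  have hOo' : IsOpen O' := F.chart.symm.isOpen_inter_preimage F₀.chart.open_source
  have hτc : (F.chart ∘ F₀.chart.symm) c = F.chart p := by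
    rw [comp_apply, hc_def, F₀.chart.left_inv hp₀]
  have hcO' : F.chart p ∈ O' := ⟨F.chart.map_source hp, by
    rw [mem_preimage, F.chart.left_inv hp]; exact hp₀⟩
  have hτ' : ContDiffOn ℝ ∞ (F₀.chart ∘ F.chart.symm) O' := by
    have := F₀.contMDiffOn.comp (F.contMDiffOn_symm.mono inter_subset_left) fun u hu => hu.2
    exact (contMDiffOn_iff_contDiffOn.1 this)
  -- points of `O` read the sides consistently in both charts
  have hread : ∀ u ∈ O, F₀.chart.symm u ∈ F₀.chart.source ∧ F₀.chart.symm u ∈ F.chart.source ∧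
      F₀.chart (F₀.chart.symm u) = u := fun u hu =>
    ⟨F₀.chart.map_target hu.1, hu.2, F₀.chart.right_inv hu.1⟩
  refine fderiv_apply_zero_pos_of_flat (τ' := F₀.chart ∘ F.chart.symm)
    ((hτ.contDiffAt hOn).of_le (by norm_cast)) ?_ ?_ ?_ ?_ ?_
  · rw [hτc]; exact (hτ'.differentiableOn (by simp)).differentiableAt (hOo'.mem_nhds hcO')
  · filter_upwards [hOn] with u hu
    obtain ⟨h1, h2, h3⟩ := hread u hu
    simp only [comp_apply, F.chart.left_inv h2, h3]
  · exact (F₀.eq_zero_iff hp₀).2 hps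
  · filter_upwards [hOn] with u hu
    obtain ⟨h1, h2, h3⟩ := hread u hu
    rw [comp_apply, F.nonneg_iff h2, ← F₀.nonneg_iff h1, h3]
  · filter_upwards [hOn] with u hu
    obtain ⟨h1, h2, h3⟩ := hread u hu
    rw [comp_apply, F.eq_zero_iff h2, ← F₀.eq_zero_iff h1, h3]

variable [T2Space M] [T2Space N] [CompactSpace M] [CompactSpace N] [IsManifold (𝓡∂ (n + 1)) ∞ N]

/-- **Seam height functions exist.** For gluing data of compact Hausdorff pieces there is a
`C^∞` function `f : P → ℝ` vanishing on the seam, positive on `jA (Int M)`, negative on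
`jB (Int N)`, and with nonzero differential at every seam point.  Construction: glue by a
smooth partition of unity on `P` the constants `1` on `jA (Int M)`, `-1` on `jB (Int N)` and the
height coordinates `p ↦ (F.chart p) 0` of flat charts `F` at the seam points (these read the
three strata as `{u 0 > 0}`, `{u 0 < 0}`, `{u 0 = 0}`); the values follow from convexity.  For
the differential at a seam point `p`, differentiate along the normal curve
`t ↦ F₀.chart⁻¹ (c₀ + t e₀)` of one flat chart: only the height coordinates of flat charts
through `p` contribute, each with derivative `ρ_i(p) · (D(F_i ∘ F₀⁻¹) e₀) 0 ≥ 0`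
(`FlatChart.fderiv_transition_apply_zero_pos`), and the weights sum to `1`.  Bröcker–Jänich
(1982), (13.18) Ex. 2 (a function with `f⁻¹(0) = ∂M`); Hirsch (1976), Ch. 6 §2 and Ch. 8 §2
(the seam as a regular level of the glued manifold). [folklore] -/
theorem exists_seamFunction : ∃ f : P → ℝ, ContMDiff (𝓡 (n + 1)) 𝓘(ℝ, ℝ) ∞ f ∧
    (∀ p ∈ G.seam, f p = 0) ∧ (∀ p ∈ G.jA '' (𝓡∂ (n + 1)).interior M, 0 < f p) ∧
    (∀ p ∈ G.jB '' (𝓡∂ (n + 1)).interior N, f p < 0) ∧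
    ∀ z : bM.carrier, mfderiv (𝓡 (n + 1)) 𝓘(ℝ, ℝ) f (G.jA (bM.incl z)) ≠ 0 := by
  haveI := G.t2Space
  haveI := G.compactSpace
  -- the open cover and the local functions
  let U : Option (Option bM.carrier) → Set P := fun i =>
    match i with
    | none => G.jA '' (𝓡∂ (n + 1)).interior M
    | some none => G.jB '' (𝓡∂ (n + 1)).interior N
    | some (some z) => (G.flatChart z).chart.source
  let loc : Option (Option bM.carrier) → P → ℝ := fun i =>
    match i with
    | none => fun _ => 1
    | some none => fun _ => -1
    | some (some z) => fun p => (G.flatChart z).chart p 0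
  have hUo : ∀ i, IsOpen (U i) := by
    rintro (_ | _ | z)
    · exact G.isOpen_image_jA_interior
    · exact G.isOpen_image_jB_interior
    · exact (G.flatChart z).chart.open_source
  have hUc : (univ : Set P) ⊆ ⋃ i, U i := by
    intro p _
    rw [mem_iUnion]
    rcases G.mem_seam_or p with ⟨z, rfl⟩ | hA | hB
    · exact ⟨some (some z), (G.flatChart z).mem_source⟩
    · exact ⟨none, hA⟩
    · exact ⟨some none, hB⟩
  obtain ⟨ρ, hρ⟩ := SmoothPartitionOfUnity.exists_isSubordinate (𝓡 (n + 1)) isClosed_univ U hUo hUc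
  have hmemU : ∀ {i p}, ρ i p ≠ 0 → p ∈ U i := fun {i p} h => hρ i (subset_tsupport _ h)
  set f : P → ℝ := fun p => ∑ᶠ i, ρ i p • loc i p with hf_def
  -- smoothness
  have hf : ContMDiff (𝓡 (n + 1)) 𝓘(ℝ, ℝ) ∞ f := by
    refine ρ.contMDiff_finsum_smul fun i p hp => ?_
    rcases i with _ | _ | z
    · exact contMDiffAt_const
    · exact contMDiffAt_const
    · have h1 : ContMDiffAt (𝓡 (n + 1)) 𝓘(ℝ, 𝔼 (n + 1)) ∞ (G.flatChart z).chart p :=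
        (G.flatChart z).contMDiffOn.contMDiffAt
          ((G.flatChart z).chart.open_source.mem_nhds (hρ _ hp))
      exact ((EuclideanSpace.proj (0 : Fin (n + 1))).contMDiff.contMDiffAt).comp p h1
  -- values on the three strata
  have hseam : ∀ p ∈ G.seam, f p = 0 := by
    intro p hp
    have := ρ.finsum_smul_mem_convex (mem_univ p) (g := loc) (t := {(0 : ℝ)}) (fun i hi => ?_)
      (convex_singleton _)
    · simpa [hf_def] using this
    · have hpU := hmemU hi
      rcases i with _ | _ | z
      · exact absurd hp (G.not_mem_seam_of_mem_image_interior hpU)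
      · exact absurd hp (G.not_mem_seam_of_mem_image_interior' hpU)
      · exact ((G.flatChart z).eq_zero_iff hpU).2 hp
  have hpos : ∀ p ∈ G.jA '' (𝓡∂ (n + 1)).interior M, 0 < f p := by
    intro p hp
    have := ρ.finsum_smul_mem_convex (mem_univ p) (g := loc) (t := Ioi (0 : ℝ)) (fun i hi => ?_)
      (convex_Ioi _)
    · simpa [hf_def] using this
    · have hpU := hmemU hi
      rcases i with _ | _ | z
      · show (0 : ℝ) < 1
        exact zero_lt_one
      · exact absurd (image_subset_range _ _ hpU) (G.not_mem_range_jB_of_mem_image_interior hp)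
      · exact ((G.flatChart z).pos_iff hpU).2 hp
  have hneg : ∀ p ∈ G.jB '' (𝓡∂ (n + 1)).interior N, f p < 0 := by
    intro p hp
    have := ρ.finsum_smul_mem_convex (mem_univ p) (g := loc) (t := Iio (0 : ℝ)) (fun i hi => ?_)
      (convex_Iio _)
    · simpa [hf_def] using this
    · have hpU := hmemU hi
      rcases i with _ | _ | z
      · exact absurd (image_subset_range _ _ hpU) (G.not_mem_range_jA_of_mem_image_interior' hp)
      · show (-1 : ℝ) < 0
        norm_num
      · exact ((G.flatChart z).neg_iff hpU).2 (G.not_mem_range_jA_of_mem_image_interior' hp)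
  refine ⟨f, hf, hseam, hpos, hneg, fun z₀ => ?_⟩
  -- the differential at the seam point `p = jA (incl z₀)`
  set p := G.jA (bM.incl z₀) with hp_def
  have hps : p ∈ G.seam := G.jA_incl_mem_seam z₀
  set F₀ := G.flatChart z₀ with hF₀
  set c₀ := F₀.chart p with hc₀
  have hp₀ : p ∈ F₀.chart.source := F₀.mem_source
  -- finitely many indices are active near `p`
  obtain ⟨I, hI⟩ := ρ.toPartitionOfUnity.exists_finset_nhds p
  have hfI : ∀ᶠ x in 𝓝 p, f x = ∑ i ∈ I, ρ i x * loc i x := by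
    filter_upwards [hI] with x hx
    rw [hf_def]
    exact finsum_eq_sum_of_support_subset _
      ((support_smul_subset_left (fun i => ρ i x) fun i => loc i x).trans hx.2)
  -- the normal curve of the flat chart `F₀`
  set γ : ℝ → P := fun t => F₀.chart.symm (c₀ + t • upNormal n) with hγ
  have hγ0 : γ 0 = p := by simp [hγ, hc₀, F₀.chart.left_inv hp₀]
  have hline : Continuous fun t : ℝ => c₀ + t • upNormal n := by fun_prop
  have htn : F₀.chart.target ∈ 𝓝 c₀ := F₀.chart.open_target.mem_nhds (F₀.chart.map_source hp₀)
  have hγc : ContinuousAt γ 0 := by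
    refine ContinuousAt.comp (g := F₀.chart.symm) ?_ hline.continuousAt
    simpa using F₀.chart.continuousOn_symm.continuousAt htn
  have hγt : Tendsto γ (𝓝 0) (𝓝 p) := by
    have := hγc.tendsto
    rwa [hγ0] at this
  -- derivative of each summand along the curve
  let e : Option (Option bM.carrier) → ℝ := fun i =>
    match i with
    | some (some z) => fderiv ℝ ((G.flatChart z).chart ∘ F₀.chart.symm) c₀ (upNormal n) 0
    | _ => 0
  have hsummand : ∀ i, HasDerivAt (fun t => ρ i (γ t) * loc i (γ t)) (ρ i p * e i) 0 := by
    intro i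
    by_cases hi : p ∈ tsupport (ρ i)
    · have hpU : p ∈ U i := hρ i hi
      rcases i with _ | _ | z
      · exact absurd hps (G.not_mem_seam_of_mem_image_interior hpU)
      · exact absurd hps (G.not_mem_seam_of_mem_image_interior' hpU)
      · -- a flat chart through `p`: product rule, the chart term via the transition map
        set F := G.flatChart z with hF
        have hpF : p ∈ F.chart.source := hpU
        set O : Set (𝔼 (n + 1)) := F₀.chart.target ∩ F₀.chart.symm ⁻¹' F.chart.source with hO
        have hOo : IsOpen O := F₀.chart.symm.isOpen_inter_preimage F.chart.open_source
        have hcO : c₀ ∈ O := ⟨F₀.chart.map_source hp₀, by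
          rw [mem_preimage, hc₀, F₀.chart.left_inv hp₀]; exact hpF⟩
        have hOn : O ∈ 𝓝 c₀ := hOo.mem_nhds hcO
        -- the weight along the curve
        have hρd : ContDiffOn ℝ ∞ (ρ (some (some z)) ∘ F₀.chart.symm) F₀.chart.target :=
          contMDiffOn_iff_contDiffOn.1
            ((ρ (some (some z))).contMDiff.comp_contMDiffOn F₀.contMDiffOn_symm)
        have hρa : HasFDerivAt (ρ (some (some z)) ∘ F₀.chart.symm)
            (fderiv ℝ (ρ (some (some z)) ∘ F₀.chart.symm) c₀) c₀ :=
          ((hρd.differentiableOn (by simp)).differentiableAt htn).hasFDerivAt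
        have hρline : HasDerivAt (fun t : ℝ => ρ (some (some z)) (γ t))
            (fderiv ℝ (ρ (some (some z)) ∘ F₀.chart.symm) c₀ (upNormal n)) 0 := by
          have hl : HasDerivAt (fun t : ℝ => c₀ + t • upNormal n) (upNormal n) 0 := by
            simpa using ((hasDerivAt_id (0 : ℝ)).smul_const (upNormal n)).const_add c₀
          exact hρa.comp_hasDerivAt_of_eq (x := (0 : ℝ)) hl (by simp)
        -- the height coordinate along the curve
        have hτ : ContDiffOn ℝ ∞ (F.chart ∘ F₀.chart.symm) O := by
          have := F.contMDiffOn.comp (F₀.contMDiffOn_symm.mono inter_subset_left) fun u hu => hu.2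
          exact contMDiffOn_iff_contDiffOn.1 this
        have hτa : HasFDerivAt (F.chart ∘ F₀.chart.symm)
            (fderiv ℝ (F.chart ∘ F₀.chart.symm) c₀) c₀ :=
          ((hτ.differentiableOn (by simp)).differentiableAt hOn).hasFDerivAt
        have hlocline : HasDerivAt (fun t : ℝ => loc (some (some z)) (γ t)) (e (some (some z))) 0 :=
          hasDerivAt_apply_zero_comp_line hτa (upNormal n)
        have hloc0 : loc (some (some z)) (γ 0) = 0 := by
          rw [hγ0]; exact (F.eq_zero_iff hpF).2 hps
        have := hρline.mul hlocline
        rw [hloc0, mul_zero, zero_add, hγ0] at this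
        exact this
    · -- an index whose weight vanishes near `p`
      have hzero : (ρ i : P → ℝ) =ᶠ[𝓝 p] 0 := notMem_tsupport_iff_eventuallyEq.1 hi
      have hρp : ρ i p = 0 := hzero.self_of_nhds
      have hev : (fun t => ρ i (γ t) * loc i (γ t)) =ᶠ[𝓝 0] fun _ => 0 := by
        filter_upwards [hγt.eventually hzero] with t ht
        simp only [Pi.zero_apply] at ht
        simp [ht]
      rw [hρp, zero_mul]
      exact (hasDerivAt_const (0 : ℝ) (0 : ℝ)).congr_of_eventuallyEq hev
  -- the derivative of `f` along the curve is positive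
  have hsum : HasDerivAt (fun t => ∑ i ∈ I, ρ i (γ t) * loc i (γ t)) (∑ i ∈ I, ρ i p * e i) 0 :=
    HasDerivAt.fun_sum fun i _ => hsummand i
  have hderiv : HasDerivAt (f ∘ γ) (∑ i ∈ I, ρ i p * e i) 0 := by
    refine hsum.congr_of_eventuallyEq ?_
    filter_upwards [hγt.eventually hfI] with t ht
    exact ht
  have hSpos : 0 < ∑ i ∈ I, ρ i p * e i := by
    have he : ∀ i, ρ i p ≠ 0 → 0 < e i := by
      intro i hi
      have hpU : p ∈ U i := hmemU hi
      rcases i with _ | _ | z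
      · exact absurd hps (G.not_mem_seam_of_mem_image_interior hpU)
      · exact absurd hps (G.not_mem_seam_of_mem_image_interior' hpU)
      · exact F₀.fderiv_transition_apply_zero_pos G (G.flatChart z) hp₀ hpU hps
    refine Finset.sum_pos' (fun i _ => ?_) ?_
    · by_cases hi : ρ i p = 0
      · rw [hi, zero_mul]
      · exact (mul_pos ((ρ.nonneg i p).lt_of_ne (Ne.symm hi)) (he i hi)).le
    · have h1 : ∑ i ∈ I, ρ i p = 1 := (hI.self_of_nhds).1
      obtain ⟨i, hiI, hi⟩ := Finset.exists_ne_zero_of_sum_ne_zero (h1.symm ▸ one_ne_zero)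
      exact ⟨i, hiI, mul_pos ((ρ.nonneg i p).lt_of_ne (Ne.symm hi)) (he i hi)⟩
  -- hence the differential of `f` at `p` is nonzero
  intro h0
  have h0' : mfderiv (𝓡 (n + 1)) 𝓘(ℝ, ℝ) f (γ 0) = 0 := by rw [hγ0]; exact h0
  have hfm : HasMFDerivAt (𝓡 (n + 1)) 𝓘(ℝ, ℝ) f (γ 0) (mfderiv (𝓡 (n + 1)) 𝓘(ℝ, ℝ) f (γ 0)) :=
    (hf.mdifferentiableAt (by simp)).hasMFDerivAt
  have hγm : MDifferentiableAt 𝓘(ℝ, ℝ) (𝓡 (n + 1)) γ 0 := by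
    have h1 : ContMDiffAt 𝓘(ℝ, 𝔼 (n + 1)) (𝓡 (n + 1)) ∞ F₀.chart.symm c₀ :=
      F₀.contMDiffOn_symm.contMDiffAt htn
    have hlc : ContDiff ℝ ∞ fun t : ℝ => c₀ + t • upNormal n := by fun_prop
    have h2 : ContMDiffAt 𝓘(ℝ, ℝ) 𝓘(ℝ, 𝔼 (n + 1)) ∞ (fun t : ℝ => c₀ + t • upNormal n) 0 :=
      contMDiffAt_iff_contDiffAt.2 hlc.contDiffAt
    have h3 := h1.comp_of_eq h2 (by simp)
    exact h3.mdifferentiableAt (by simp)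
  have hcomp := hfm.comp 0 hγm.hasMFDerivAt
  rw [h0', ContinuousLinearMap.zero_comp] at hcomp
  have h4 : HasDerivAt (f ∘ γ) 0 0 := by
    have h5 : HasFDerivAt (f ∘ γ) (0 : ℝ →L[ℝ] ℝ) 0 := hasMFDerivAt_iff_hasFDerivAt.1 hcomp
    simpa using h5.hasDerivAt
  exact hSpos.ne' (hderiv.unique h4)

/-- **Seam height functions: the strata as sign sets.** A convenient repackaging of
`exists_seamFunction`: `f = 0` exactly on the seam, `f > 0` exactly on `jA (Int M)`, `f < 0`
exactly on `jB (Int N)`, `f ≥ 0` exactly on `range jA`, and `0` is a regular value. [folklore] -/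
theorem exists_seamFunction_iff : ∃ f : P → ℝ, ContMDiff (𝓡 (n + 1)) 𝓘(ℝ, ℝ) ∞ f ∧
    (∀ p, f p = 0 ↔ p ∈ G.seam) ∧ (∀ p, 0 < f p ↔ p ∈ G.jA '' (𝓡∂ (n + 1)).interior M) ∧
    (∀ p, f p < 0 ↔ p ∈ G.jB '' (𝓡∂ (n + 1)).interior N) ∧
    (∀ p, 0 ≤ f p ↔ p ∈ range G.jA) ∧ (∀ p, f p ≤ 0 ↔ p ∈ range G.jB) ∧
    ∀ p, f p = 0 → mfderiv (𝓡 (n + 1)) 𝓘(ℝ, ℝ) f p ≠ 0 := by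
  obtain ⟨f, hf, hseam, hpos, hneg, hreg⟩ := G.exists_seamFunction
  have key : ∀ p, (f p = 0 ↔ p ∈ G.seam) ∧ (0 < f p ↔ p ∈ G.jA '' (𝓡∂ (n + 1)).interior M) ∧
      (f p < 0 ↔ p ∈ G.jB '' (𝓡∂ (n + 1)).interior N) := by
    intro p
    rcases G.mem_seam_or p with hs | hA | hB
    · have h := hseam p hs
      refine ⟨⟨fun _ => hs, fun _ => h⟩, ⟨fun h' => ?_, fun h' => ?_⟩, ⟨fun h' => ?_, fun h' => ?_⟩⟩
      · rw [h] at h'; exact absurd h' (lt_irrefl 0)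
      · exact absurd hs (G.not_mem_seam_of_mem_image_interior h')
      · rw [h] at h'; exact absurd h' (lt_irrefl 0)
      · exact absurd hs (G.not_mem_seam_of_mem_image_interior' h')
    · have h := hpos p hA
      refine ⟨⟨fun h' => ?_, fun h' => ?_⟩, ⟨fun _ => hA, fun _ => h⟩, ⟨fun h' => ?_, fun h' => ?_⟩⟩
      · rw [h'] at h; exact absurd h (lt_irrefl 0)
      · exact absurd h' (G.not_mem_seam_of_mem_image_interior hA)
      · exact absurd (h.trans h') (lt_irrefl 0)
      · exact absurd (image_subset_range _ _ h') (G.not_mem_range_jB_of_mem_image_interior hA)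
    · have h := hneg p hB
      refine ⟨⟨fun h' => ?_, fun h' => ?_⟩, ⟨fun h' => ?_, fun h' => ?_⟩, ⟨fun _ => hB, fun _ => h⟩⟩
      · rw [h'] at h; exact absurd h (lt_irrefl 0)
      · exact absurd h' (G.not_mem_seam_of_mem_image_interior' hB)
      · exact absurd (h'.trans h) (lt_irrefl 0)
      · exact absurd (image_subset_range _ _ hB) (G.not_mem_range_jB_of_mem_image_interior h')
  refine ⟨f, hf, fun p => (key p).1, fun p => (key p).2.1, fun p => (key p).2.2, fun p => ?_,
    fun p => ?_, fun p hp => ?_⟩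
  · rw [le_iff_lt_or_eq, (key p).2.1, eq_comm, (key p).1]
    constructor
    · rintro (h | h)
      · exact image_subset_range _ _ h
      · exact G.seam_subset_range_jA h
    · rintro ⟨a, rfl⟩
      by_cases ha : a ∈ (𝓡∂ (n + 1)).interior M
      · exact Or.inl ⟨a, ha, rfl⟩
      · right
        rw [G.jA_mem_seam_iff, bM.range_incl, ← ModelWithCorners.compl_interior]
        exact ha
  · rw [le_iff_lt_or_eq, (key p).2.2, (key p).1]
    constructor
    · rintro (h | h)
      · exact image_subset_range _ _ h
      · exact G.seam_subset_range_jB h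
    · rintro ⟨b, rfl⟩
      by_cases hb : b ∈ (𝓡∂ (n + 1)).interior N
      · exact Or.inl ⟨b, hb, rfl⟩
      · right
        rw [← G.symm_seam]
        refine (G.symm.jA_mem_seam_iff b).2 ?_
        rw [bN.range_incl, ← ModelWithCorners.compl_interior]
        exact hb
  · obtain ⟨z, rfl⟩ := ((key p).1).1 hp
    exact hreg z

end BoundaryGluingData

end SeamFunction

end Literature.Topology.FourManifolds
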